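import Summits.ResolutionOfSingularities.ResolutionOfSingularities.Theorems.RelativeDeltaCutClasses
import Summits.ResolutionOfSingularities.ResolutionOfSingularities.Theorems.DeltaFaceCutKernels
import HarnessLib

/-!
# CurveLeafExit — the CURVE stratum of the non-isolated core cut by its two LEAF ENGINES: the `v`-ADIC (relative)
δ-face over `𝒪_{C,y}` at a δ-JUMP point, and the NORMAL-CONE JUMP of a relatively FLAT curve
(decomp-res lens-2 «structural dichotomy (special vs generic)», g13)
[WRITER NOTE (decomp-res writer g5): tree file 1/3 of the lens-2 g13 node «CurveLeafExit» (HOME decomp-res-lens-2/g13/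
CurveLeafExit.lean, sha256 cbe610aaf56bd15d, critic row 90 CLEARED): §N1–§N4 (the NEW classes) VERBATIM,
statement-only; namespace
`…Theorems.CurveLeafExit` (the lens's `Theses.CurveLeafExit` is gate-reserved).  The lens's §R «RESTATED
VERBATIM from lens-2 g12
RelativeDeltaCut» is DELETED: g12 is the tree's `RelativeDeltaCutClasses` (namespace `RelativeDeltaCut`, opened).
§K kernels =
`CurveLeafExitKernels` (with the bed-row arithmetic examples); the kernels and edges reaching 29273 `MaxContactCut.RungOne`,
32106/32107, 31576/31577 and g12's rungs BY NAME = `MaxContactCutCurveLeafExit`.  The lens header below is kept verbatim.]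

ROOT DECOMPOSITION CELL `decomp-res`, RESIDUAL MODE (D-0179), generation 13.  TARGET (tree items, BY NAME):
`MaxContactCut.RungOne` (stmt-29273, `E 2 → E 1`, the dimension-four core of the order axis in SEQUENCE form), with the
map edges to `MaxContactCut.StepPICoreDimFour` (28544, kernel `MaxContactCutTauLadder.closes`) and to
`MaxContactCut.ClosedPointCoreAll` (30461, kernel `MaxContactCutGenericPointCut.rungOne_iff_core_of_rounds`), refinement
edges BY NAME to the tree's g10 asides `MaxContactCut.VNGenericRung` 32106 / `VNSpecialRung` 32107, the g9 asides
`FFGenericRung` 31576 / `FFSpecialRung` 31577, the tree's g11 rungs `DeltaFaceCutClasses.DeltaGenericRung /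
DeltaSpecialRung` (landed `Theorems.DeltaFaceCutClasses` + `DeltaFaceCutKernels`, used BY NAME through `open
…Theorems.DeltaFaceCutClasses` — NOTHING of g11 is restated any more), and to lens-2 g12 `RelativeDeltaCut` (critic
CLEARED 2026-08-30T11:51:12Z row 85, writer filing pending as `Theorems.RelativeDeltaCutClasses`): its §3–§5 (the curve
prime, `IsRelDeltaGenericAt`, `IsCurvePt`, `IsTopIsolatedClosure`, `IsUniformDeltaCurve`, `PackageExitsOver`, the engine
`UniformCurvePackageExit`, the port `CurvePackagePort`, the classes `IsCurveGenericPt / IsRelSpecialPt / OnCleanCurve`,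
the schemas `SeqRGen … SeqRSpecTangle`, the rungs `RelGenericRung / RelSpecialRung`) are RESTATED VERBATIM in §R below
and become `open …Theorems.RelativeDeltaCutClasses` on filing.

CRITIC DIRECTION HONOURED (CRITIC-LEDGER row 85, LENS-2 g13 POINTER in the 11:50:45Z clearance): «the CURVE stratum
`SeqRSpecCurve n` of g12 carries the only non-Round content left in the non-isolated column: type its two leaf engines —
the RELATIVE (v-adic) δ-face genericity over `𝒪_{C,y}` at a δ-JUMP point (bed `KV59 z⁴ + x²y⁶ + …`,
`insep xy¹⁰ / xy²⁶`:
g12's reading (N) acquires the `v`-adic order of the face coefficient) and the NORMAL-CONE JUMP exit of a relatively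
FLAT curve (`Z² + xy²`, `Z² + y²z`, `Z³ + w³u`, `Z³ − x³t`: one blow-up of the curve resolves); predicted bed +7».
THIS NODE'S TWO NEW OBJECTS are exactly those, typed at HYPOTHESIS level (a presentation shape at each closed point of
the curve), bridged by two ENGINES with paper proofs below, and consumed by g12's port `CurvePackagePort` UNCHANGED (both
engines conclude g12's `PackageExitsOver I n (closure {η})`, so the new decided points are g12 `IsCurveExitPt`s BY
LETTER — no new port, no new costume).

## (A) The `v`-PREPARED relative δ-face at a closed point `y` of the top curve `C = {y' : η ⤳ y'}`

`R := 𝒪_{Y,y}` (regular local), `𝔭 := curvePrime (η ⤳ y)`, parameters `c = (z, u₁, …, u_d) ⊂ R` with `(c) = 𝔭` and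
ONE inert parameter `v ∈ R` with `(c, v) = 𝔪_y` MINIMALLY (`spanFinrank 𝔪_y = d + 2`; so `R/(c) = 𝒪_{C,y}` is regular
of dimension `(d + 2) − (d + 1) = 1`: a DVR with uniformizer `v̄` — no catenarity needed), and FACE DATA: a finite set
`S` of exponents `α = (i, β) ∈ ℕ^{d+1}`, `v`-ORDERS `γ_α ∈ ℕ` and UNIT coefficients `λ_α ∈ R×`, assembled into
`F := Σ_{α ∈ S} v^{γ_α} λ_α X^α` (`vFace S γ λ v`) with the tree's `HasDeltaFace c I_y n a b F` VERBATIM (`0 < b < a`,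
`F` on weight `a i + b|β| = an` with `i < n`, `I_y ∋ zⁿ + F(c) + G(c)`, `G` on weight `> an`, `I_y ⊆ Q(an)`).  (Every
δ-face presentation over `R` can be `v`-PREPARED on paper: a coefficient `r_α ∉ 𝔭` is `≡ v^{γ} λ (mod
𝔭)` with `λ` a
unit because `R/𝔭` is a DVR, and the correction `(r_α − v^γ λ) c^α ∈ 𝔭·c^α = (c)·c^α` is an
`R`-combination of monomials
of weight `> an`, i.e. goes into `G`; a coefficient `r_α ∈ 𝔭` goes into `G` entirely.  In Lean the prepared shape is
DATA of the class and g12's unprepared class `IsCurveGenericPt` stays a separate disjunct.)  LAYERS over `k(y)`: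
`Q_{i,g} := Σ_{α ∈ S, α₀ = i, γ_α = g} λ̄_α X^α` (`vLayer`), the BOTTOM layer of `Z`-degree `i` is `g = γ(i) :=
min {γ_α : α₀ = i}`; `Q₀ := Σ_{γ_α = 0} λ̄_α X^α = F mod 𝔪_y` (`vLayerZero`).  RELATIVE GENERICITY
(`RelDeltaGenericFace`, three decided modes; `θb := thetaNum a b = b − (a mod b)`, `t_i := θ(n − i)`):
* (G1ʳ) `RelThresholdGeneric`: `b ∤ a` and at EVERY geometric `U`-direction `w ≠ 0` (`w₀ = 0`; the points of the fibre
  `ℙ^{d−1}` of `C_m → C` over `y`) SOME `Z`-degree `i` has, in its BOTTOM layer `g` (`g ≤ γ_α` for all `α ∈ S` with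
  `α₀ = i`), a monomial `Zⁱ U^β` of the translate `Q_{i,g}(Z, U + w)` with `θb·i + b·(|β| + g) < θb·n`, i.e.
  `g + |β| < t_i`;
* (G2ʳ) `RelThresholdGenericPow`: the same with `≤` and `n = (char k(y))^e`;
* (G3ʳ) `SolvGeneric Q₀ n a b` (tree, `b ∣ a`) — the `γ = 0` layer only (higher layers never reach degree `n` when
  `δ ∈ ℤ`; no relative gain, honest).
At a NON-jump point (`γ ≡ 0`) (G1ʳ)/(G2ʳ)/(G3ʳ) are literally g11's G1/G2/G3 for `F̄ = Q₀`; at a JUMP point `F̄` loses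
the layers `γ ≥ 1` (bed: `F̄ = 0`) and g11/g12 are blind, while (G1ʳ)/(G2ʳ) read them with the weight `g`.
`IsRelJumpGenericAt I n a b η y` := such data exist; `IsUniformRelCurve I n a b η` := `IsCurvePt η` and every closed
point of `C` is relatively jump-generic of the SAME `(n, a, b)` with the equicharacteristic guard `char k(y) = char κ(η)`
(automatic over a field); the KIND (G1ʳ/G2ʳ/G3ʳ) may vary along `C` (bed `KV59`: G1 at `x ≠ 0`, G2ʳ at the origin).

## ENGINE (A) `RelCurvePackageExit` [DECIDED · paper proof · characteristic free · every regular scheme]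

CLAIM.  `Y` regular, locally noetherian, `n ≥ 2`, `IsUniformRelCurve I n a b η`, `C := {y' : η ⤳ y'}`.  Then
`PackageExitsOver I n C` by g12's CURVE PACKAGE `(π₁, …, π_m)`, `m = ⌈a/b⌉ − 1` (`π₁` blows up `C`,
`π_{j+1}` blows up
`C_j := Top(I^{(j)}) ∩ E_j`): weakly admissible, centres over `C`, regular top, and every point `x` of `Y_m` over `C`
with `ord_x I^{(m)} = n` has `τ(x) ≥ 2`.
PROOF.  Steps (0r) local model and spreading over an open `V ∋ y`, (1r) admissibility of `C` and of the `C_j`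
(`j ≤ m − 1`: every summand of the transform has order `≥ n` at EVERY point of `V(z_j, u₁)`, closed or not
— no density
argument), (2r) location `Top(I^{(j)}) ∩ E_j = V(z_j, u₁) = C_j` (intrinsic ⇒ the local models GLUE; `C_j` regular,
`C_m ≅ C₁` a `ℙ^{d−1}`-bundle over `C ∩ V` with fibre coordinates `ũ`), covering of the points over `η`
by the model of
any closed point, are g12's VERBATIM (they never read the coefficients).  (3rʳ) THE TEST.  In the A-chart over `V` the
controlled transform is `f^{(m)} = z_mⁿ + Σ_i z_mⁱ u₁^{e(i)} Ψ_i + Σ_{G} z_m^{i'} u₁^{e'} (…)` with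
`e(i) = (δ − m)(n − i) =
(1 − θ)(n − i)`, `Ψ_i = Σ_{α₀ = i} λ_α v^{γ_α} ũ^{α'}` (`u^β = u₁^{|β|} ũ^{β'}`; the inert `v`
and the units `λ_α` ride
along untouched by the blow-ups, whose centres `(z_j, u₁)` do not contain `v`), and every `G`-summand has `e' > e(i')`.
EXPONENT FACT: `f^{(m)} ≡ z_mⁱ u₁^{e(i)} Ψ_i (mod 𝔠_i)`, `𝔠_i := (z_m^{i+1}, u₁^{e(i)+1})` — because `z_mⁿ ∈ (z_m^{i+1})`,
a face summand `i' > i` is in `(z_m^{i+1})`, `i' < i` has `e(i') > e(i)` (as `θ < 1`), a `G`-summand has `i' > i` or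
`e' > e(i') ≥ e(i)`; coefficients in `R` need no expansion (ideal membership only).  LEMMA (†) (any regular local `A`,
r.s.o.p. `(z, u, t)`, `A₀ := A/(z, u)`, `g ∈ A` with `ord_{A₀} ḡ = s`; `h ∈ zⁱuᵉ g + (z^{i+1}, u^{e+1})`): `ord_A h ≤
i + e + s`, and if `=`, the `(Z, U)`-bidegree-`(i, e)` component of `in(h) ∈ κ[Z, U, T]` is `ZⁱUᵉ · in(ḡ)(T) ≠ 0`.
[Proof: `in((z^{i+1}, u^{e+1})) = (Z^{i+1}, U^{e+1})` (two coprime monomials in a r.s.o.p.: a cancelling pair of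
leading forms `in(a)Z^{i+1} = −in(b)U^{e+1}` lifts and is removed, raising the formal order, which is bounded by
`ord h`); write `g = z c₁ + u c₂ + g'` with `in(g') ∉ (Z, U)` by the same lifting iteration (it terminates below
`ord_{A₀} ḡ + 1` since `ḡ' = ḡ`), so `ord g' = ord ḡ' = s` and `in(g') ≡ in(ḡ) (mod (Z, U))`; then `h
= zⁱuᵉ g' + k`,
`k ∈ (z^{i+1}, u^{e+1})`, `ord(zⁱuᵉg') = i + e + s` with bidegree-`(i,e)` component `ZⁱUᵉ in(ḡ)`, and `in(k) ∈
(Z^{i+1}, U^{e+1})` has none.]  With `A = 𝒪_{Y_m,x}`, `A₀ = 𝒪_{C_m,x}`, `s_i(x) := ord_x(Ψ_i|_{C_m})` (chart-free: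
on overlaps the `Ψ_i` differ by the unit `ũ_k^{e(i) − mi}`): (N≤) `ord_x f^{(m)} ≤ i + e(i) + s_i(x)` for every face
degree `i`; (I) at a NEAR point (`ord = n`, hence `s_i(x) ≥ t_i` for all `i`) with `s_i(x) = t_i` the bidegree-`(i,
e(i))` component of `in_n(f^{(m)})` is `Zⁱ U₁^{e(i)} · in_{t_i}(Ψ_i|_{C_m})`, un-cancelled.  THE `v`-ADIC READING at `x`
over `y` (`A₀ = 𝒪_{C_m,x}` regular of dimension `d`, parameters: fibre coordinates `w̃` and `v`): `Ψ_i|_{C_m} =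
v^{γ(i)}·g` with `g mod v = Q_{i,γ(i)}(ũ)` on the fibre `𝔸^{d−1}_{k(y)}` (layers `γ_α > γ(i)` die mod
`v`; `λ_α ↦ λ̄_α`
on the fibre, a `k(y)`-scheme).  Since `gr(A₀)` is a domain, `s_i(x) = γ(i) + ord_{A₀} g` EXACTLY and
`in_{s_i}(Ψ_i|_{C_m}) = V^{γ(i)}·in(g)`; and `ord_{A₀} g ≤ ord_x(Q_{i,γ(i)}|_{fibre}) ≤ |β|` for every `U^β` in the
support of the translate `Q_{i,γ(i)}(Z, U + w)` at a geometric point `w` over `x` (a local map does not lower orders;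
the multiplicity of a form at `[w]` is the least `|β|` of its Taylor translate — g11's convention).  CONCLUSIONS over
`y`: (G1ʳ) ⇒ some `s_i(x) ≤ γ(i) + |β| < t_i` ⇒ `ord_x f^{(m)} < n` by (N≤): NO near point over `y`.  (G2ʳ) ⇒ some
`s_i(x) ≤ t_i`; at a near point (N≤) forces `s_i(x) ≥ t_i`, so `s_i(x) = t_i` and by (I) the bidegree-`(i, e(i))`
component of `in_n(f^{(m)})` is `Zⁱ U₁^{e(i)} · V^{γ(i)} in(g)(V, W) ≠ 0`; EVERY monomial of it is MIXED (`0 ≤ i < n`,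
and for `i = 0`: `0 < e(0) = (1−θ)n < n`), so `in_n ≠ c·L^{pᵉ}` (`n = pᵉ`, `p = char κ(x) = char k(y)`; an `L^{pᵉ}`
has no mixed monomial in any coordinates) and `τ(x) ≥ 2` (`in_n(f^{(m)})` lies in the degree-`n` initial ideal of
`I^{(m)}_x`, whose `τ` is at least that of one member).  (G3ʳ) (`θ = 0`, `e(i) = n − i`, `t_i = 0`, every point of `C_m`
near): `in_n(f^{(m)}) = Zⁿ + Σ_i Ψ_i(x) Zⁱ U₁^{n−i}` (`G`-summands have `i' + e' > n`) `= Zⁿ +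
Q₀`-binary form at `x`,
not an `n`-th power of a linear form by `SolvGeneric Q₀`: `τ ≥ 2` — g11's (3) verbatim.  TRANSFER TO THE POINTS OVER `η`
(from the model of ONE closed `y₀ ∈ C`, spread over `V`): the loci `S₁ := {x ∈ C_m|_V : ord_x I^{(m)} ≥ n}`,
`S₂ := ⋂_i {x : s_i(x) ≥ t_i + 1}`, `S₃ := {x : (Ψ_i(x))_i ∈ im(t ↦ (binom(n,i) t^{n−i})_i)}` are CLOSED (upper
semicontinuity of order; `s_i` chart-free; a finite morphism is closed), `C_m|_V → C ∩ V` is proper, the relevant `S_k`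
has EMPTY fibre over `y₀` ((Gkʳ) at `y₀` empties it at every closed point of the fibre `ℙ^{d−1}_{k(y₀)}`,
geometric points included, and a non-closed point of the fibre specialises inside the proper fibre to a closed one, under
which the order, the `s_i` and membership in the closed `S₃` can only persist or grow), so its image is a closed subset
of the irreducible curve `C ∩ V` missing `y₀`, hence missing `η`; therefore every `x` over `η` satisfies the
same alternative, and (N≤)/(I)/(†) — valid in ANY regular local ring, in particular at points over `η` where
`𝒪_{C_m,x}`
has only fibre parameters — give the same conclusion (`char κ(x) = char κ(η) = char k(y₀)` by the guard).  ∎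
WHY THE BOTTOM LAYER ONLY: a unit `λ_α = λ̄_α + μ v + …` of a LOWER layer feeds `μ v^{γ_α+1} ũ^{α'}` into the next
layer and can cancel its leading part, so higher-layer witnesses are not robust; the bottom layer of each `Z`-degree is
exact.  WHY `V̄` IS NOT TRANSLATED: the points over `y` have `v = 0`; a direction with `V̄`-component is no point.

## (B) The relatively FLAT curve and ENGINE (B) `NormalConeJumpExit` [DECIDED · paper proof · every regular scheme]

`IsFlatOneAt I n η y`: `d = 1` — `c = (z, u)` with `(c) = 𝔭`, inert `v`, `(c, v) = 𝔪_y` minimal (`spanFinrank = 3`: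
`Y` is a threefold at `y`, `C` a curve of codimension two), a unit `λ` and `g ∈ (c)^{n+1}` with `zⁿ +
λ·v·uⁿ + g ∈ I_y`
and `I_y ⊆ (c)ⁿ` (relative slope EXACTLY ONE: the transversal initial form `Zⁿ + λvUⁿ` acquires the root `Z
= (λv)^{1/n}U`
only after adjoining it — over the perfect closure of `k(C)` when `n = p`: Whitney's umbrella and its kin; for every
slope `a/b > 1`, `I_y ⊄ Q(an)` because `v uⁿ` has weight `bn < an`, so g11/g12/(A) do not apply).  CLAIM: `Y` regular,
`n ≥ 2`, `IsUniformFlatCurve I n η` (`IsCurvePt η` and `IsFlatOneAt` at every closed point of `C`) ⇒ `PackageExitsOver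
I n C` with the ONE-STEP package `(π₁)` = the blow-up of `C`, and NO near point at all.  PROOF.  `C` is regular
(`𝒪_{C,y} = R/(c)`, `(c, v)` minimal) and `C ⊆ Supp(I, n)` (`I_y ⊆ 𝔭ⁿ`, localise at `η`: `I_η ⊆
𝔪_ηⁿ`; `ord ≤ n`
persists), so `π₁` is weakly admissible with centre over `C` and regular top.  Over an open `V ∋ y` where the
presentation spreads: `u`-chart (`z = z₁u`): `f' = u^{−n} f = z₁ⁿ + λ v + u·h` (`g ∈ (z,u)^{n+1}`
becomes a multiple of
`u`); at a point `x ∈ E₁ = {u = 0}` over `y` (`v(x) = 0`): if `z₁(x) ≠ 0` then `f'(x) = z₁(x)ⁿ ≠ 0`, order `0`; if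
`z₁(x) = 0` then `(z₁, u, v)` is a r.s.o.p. at `x` and `f' ≡ λ̄ V + h(x) U (mod 𝔪_x²)` with `λ̄ ≠ 0`: ORDER ONE.
`z`-chart (`u = u₁z`): `f' = 1 + λ v u₁ⁿ + z·h'`, a unit along `E₁ ∩ {over y}`.  So every point over a
closed point of
`C ∩ V` has order `≤ 1 < n`; the locus `{ord ≥ n} ∩ π₁⁻¹(C ∩ V)` is closed with proper image in `C
∩ V` missing `y`,
hence missing `η`: no point over `C` is near, and the exit clause holds vacuously.  ∎  WHY `d = 1` ONLY: for `d ≥ 2`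
the flat shape is `zⁿ + v·M(u)` with `M` a degree-`n` form on `ℙ^{d−1}`; over a root of `M` the transform
`z₁ⁿ + vM(1,
ũ) + u(…)` re-creates the umbrella one dimension up (`Z² + v(U₁ + U₂)²`): not decided here (TANGLE/fourfold material).

## Pieces, tags, «why strictly weaker», edges (NODE-g13.md has the table with evidence and leaves)

* `LeafGenericRung` [WEAKER · DECIDED-MOD-PORT(M+)]: `E 2 →` weak order reduction for data ALL of whose top points are
  of class ≥ 2, near-generic (g10, tree `VeryNearExit`), δ-generic (g11, tree `DeltaPackageExit`), curve-generic (g12,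
  `UniformCurvePackageExit`), REL-CURVE-GENERIC (NEW, engine (A) `RelCurvePackageExit`) or FLAT-CURVE (NEW, engine (B)
  `NormalConeJumpExit`); kernel `leafGenericRung_of_engines` from the five engines, g12's port `CurvePackagePort n`
  [COSTUME(M+), restated, UNCHANGED] and the tree port `OrderOneContact` [COSTUME(S)].  Strictly weaker: excludes
  every datum with a leaf-special core point (bed: `CossartPiltant2019` Rem. 3.2 cylinder, Giraud, HauserE7
  `x² + y⁷ + yz⁴`, the binary towers); decided: engines paper-proved above, ports bookkeeping.  ⊋ g12
`RelGenericRung` (kernel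
  `relGenericRung_of_leafGenericRung`; bed +7: JUMP 3 + FLAT-1 4).
* `LeafSpecialRung` [WEAKER BY LETTER · located residual · UNDECIDED · cofinal ⇒ score 0]: data with a LEAF-SPECIAL
  core top point (relatively special à la g12 AND on no Top-isolated uniformly rel-generic curve AND on no Top-isolated
  uniformly flat curve); EXACT `RungOne ⟺ LeafGenericRung ∧ LeafSpecialRung` (`rungOne_iff`); sub-cuts ISO/NONISO
  (`leafSpecialRung_iff_iso`) and CURVE/TANGLE of the non-isolated column (`seqLSpecNonIso_iff`); what is LEFT in the
  CURVE stratum `SeqLSpecCurve`: FLAT-δ (uniformly δ-special REGULAR curves of slope `> 1`: `ppinch:e2 z² + xy⁴`,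
  `ppinch:p3e2 v³ + w⁹u` — Round material BY NAME 30458/30459 for principal data, 30460 open for non-principal),
  SINGULAR Top-isolated top curves (`HauserE7 x² + y⁷ + yz⁴`: the cusp `(t², t³)`; `Narasimhan x² + yz³ +
zw³ + y⁷w`:
  the monomial curve `(t³², t⁷, t¹⁹, t¹⁵)` — census T-uniform 2026-08-30T12:30:53Z), HIGHER pinch points
(`τ(η) ≥ 2 >
  τ(y)` not of the FLAT-1 shape, e.g. `zⁿ + v²uⁿ`: the FLAT-1 points are the simplest pinch points and have LEFT), flat
  curves in a fourfold (`d = 2`).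
* Edges BY NAME (§E): `LeafGenericRung → RelGenericRung (g12) → VNGenericRung (32106) → FFGenericRung (31576)`,
  `→ DeltaGenericRung` (tree g11); `FFSpecialRung (31577) → VNSpecialRung (32107) → RelSpecialRung (g12) →
  LeafSpecialRung`, `DeltaSpecialRung (tree g11) → LeafSpecialRung`; `SeqRSpecCurve n → SeqLSpecCurve n` (the stratum
  this node cuts SHRINKS by letter); honesty iff's modulo the decided half; `closes_core` (28544),
  `closes_closedPointCore` (30461).

## HONESTY IN g7/g8 CURRENCY, bed (desk reading of g11's T-delta-bed NONISO column, 27 in-frame rows)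

Every bed row is PRINCIPAL; in CONFINEMENT currency every in-frame non-isolated row is Round material (`RoundCodimTwoAll`
30458 DECIDED, `RoundCodimThreePrincipalAll` 30459 KNOWN-MOD-PORT); the schema-level open content of the column is
`RoundCodimThreeAll` (30460, NON-principal) + `ClosedPointCoreAll` (30461).  What THIS node adds is EXIT currency for a
typed class of non-isolated core points of ALL ideals (principal or not): explicit face-dictated packages with
positive-dimensional centres and proofs that they exit.  DECIDED NOW (CURVE column): g12's 3 (`cuspline:2:m5`,
`cuspGamma:2:b3`, `cuspGamma:3:b4`) + JUMP 3 (`KV59 z⁴ + x²y⁶ + x²y¹⁰ + x³y⁹`, `p = 2`: `C` = `x`-axis,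
`c = (z, y)`,
`v = x`, `F = v²·U⁶` (the terms `v²U¹⁰`, `v³U⁹` have weight `20, 18 > 12 = an`: `G`-terms), slope `3/2`, `θb = 1`,
`m = 1`, layer `γ = 2`: `2·(0 + 2) = 4 ≤ 1·4` — (G2ʳ), near point `(Z′² + XY)²`, `τ = 3`; at
`x ≠ 0` plain G1; `insep:3:xy10` `Z³ + xy¹⁰`, `p = 3`: slope `10/3`, `θb = 2`, `m = 3`, `γ = 1`: `3·(0 + 1)
= 3 < 2·3` —
(G1ʳ), transform `z₃³ + xy` of order `2 < 3`; `insep:5:xy26`: slope `26/5`, `θb = 4`, `m = 5`, `γ = 1`: `5 <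
20` — (G1ʳ),
`z₅⁵ + xy`) + FLAT-1 4 (Whitney `z² + xy²` and `monomialcyl x² − y²z` in `p = 2` — at `x₀ ≠ 0` re-centre
`z + √x₀·y` over perfect `k`; `ppinch:p3e1 v³ + w³u`, `frobline y³ − tx³` in `p = 3`; all `λ = ±1`, `g
= 0`, `d = 1`
in `𝔸³`) = 10 of 27; FLAT-δ 2 (`ppinch:e2`, `ppinch:p3e2`) + SINGULAR top curve 2 (`HauserE7`, `Narasimhan`) + TANGLE 13
remain (Round material BY NAME).  CERTIFIED by census-1's T-uniform + T-delta-jump + T-normalcone (DONE 2026-08-30T12:30:53Z,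
kit j340297, `census/tuni/T-uniform.md`): UNIFORM 3 / JUMP 3 ((G1ʳ)/(G2ʳ) verdicts 3/3, packages through the jump point exit
3/3, KV59 near point `in = (z² + ty)²`, `τ ≥ 2`) / FLAT-1 4 (max ord on `E₁` = 1, 4/4; the `d = 2` control
keeps order `n`) /
FLAT-δ 2 / SINGULAR@0 2 (my g12 `HauserE7`/`Narasimhan` readings corrected) / TANGLE 13.  ISO column: g11's three
binary towers.
-/

open CategoryTheory AlgebraicGeometry TopologicalSpace IsLocalRing
open Literature.AlgebraicGeometry.Resolution
open Summit.ResolutionOfSingularities.ResolutionOfSingularities.Theorems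
open Summit.ResolutionOfSingularities.ResolutionOfSingularities.Theorems.WeakOrderReduction
open Summit.ResolutionOfSingularities.ResolutionOfSingularities.Theorems.DeltaFaceCutClasses
open Summit.ResolutionOfSingularities.ResolutionOfSingularities.Theorems.RelativeDeltaCut

namespace Summit.ResolutionOfSingularities.ResolutionOfSingularities.Theorems.CurveLeafExit

/-! ## §N1  NEW (g13): ring level — the `v`-PREPARED face polynomial, its `v`-adic LAYERS over the residue field, and
the three RELATIVE genericity modes (G1ʳ) (G2ʳ) (G3ʳ) -/

section RelFace

variable {R : Type} [CommRing R] {d : ℕ}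

/-- **`vFace S γ lam v`** — the `v`-PREPARED face polynomial `Σ_{α ∈ S} v^{γ α}·(lam α)·X^α` over the coefficient
ring `R = 𝒪_{Y,y} ∋ v`: exponent set `S`, `v`-orders `γ`, coefficients `lam` (units, in the class predicate).
DEFINITION (NEW object: the face with its `v`-adic jump data). (Sources: Hironaka1967; CossartJannsenSaito2020 Ch. 8.) -/
noncomputable def vFace (S : Finset (Fin (d + 1) →₀ ℕ)) (γ : (Fin (d + 1) →₀ ℕ) → ℕ)
    (lam : (Fin (d + 1) →₀ ℕ) → R) (v : R) : MvPolynomial (Fin (d + 1)) R :=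
  S.sum fun m => MvPolynomial.monomial m (v ^ γ m * lam m)

end RelFace

section RelGenericity

variable {K : Type} [Field K] {d : ℕ}

/-- **`vLayer S γ lamBar i g`** — the LAYER of `Z`-degree `i` and `v`-order `g` of the prepared face, read over the
residue field: `Σ_{α ∈ S, α₀ = i, γ α = g} lamBar α · X^α ∈ k(y)[Z, U]` (`lamBar = λ mod 𝔪_y`).
The BOTTOM layer of
degree `i` (`g = min γ` on `α₀ = i`) is what the transform's `𝒪_{C_m,x}`-order reads exactly (module docstring (3rʳ)).
DEFINITION (NEW object). (Sources: Hironaka1967; CossartPiltant2008 proof of Prop. 4.2.) -/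
noncomputable def vLayer (S : Finset (Fin (d + 1) →₀ ℕ)) (γ : (Fin (d + 1) →₀ ℕ) → ℕ)
    (lamBar : (Fin (d + 1) →₀ ℕ) → K) (i g : ℕ) : MvPolynomial (Fin (d + 1)) K :=
  (S.filter fun m => m 0 = i ∧ γ m = g).sum fun m => MvPolynomial.monomial m (lamBar m)

/-- **`vLayerZero S γ lamBar`** — the `v`-order-`0` layer `Σ_{γ α = 0} lamBar α · X^α`, i.e. `F mod 𝔪_y` for
`F = vFace S γ lam v` (`v ∈ 𝔪_y` kills the layers `γ ≥ 1`): g11/g12's δ-initial form.  DEFINITION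
(support). (Sources: Hironaka1967.) -/
noncomputable def vLayerZero (S : Finset (Fin (d + 1) →₀ ℕ)) (γ : (Fin (d + 1) →₀ ℕ) → ℕ)
    (lamBar : (Fin (d + 1) →₀ ℕ) → K) : MvPolynomial (Fin (d + 1)) K :=
  (S.filter fun m => γ m = 0).sum fun m => MvPolynomial.monomial m (lamBar m)

/-- **(G1ʳ) `RelThresholdGeneric S γ lamBar n a b`** (`δ = a/b ∉ ℤ`): at EVERY geometric `U`-direction `w ≠ 0`
(`w₀ = 0`: a point of the fibre `ℙ^{d−1}` of `C_m → C` over `y`; `V̄` is NOT translated — the points over `y` have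
`v = 0`) some `Z`-degree `i` has in its BOTTOM layer `g` a monomial `ZⁱU^β` of the translate `Q_{i,g}(Z, U + w)` with
`θb·i + b·(|β| + g) < θb·n` (`g + |β| <` the threshold `θ(n − i)`): the `v`-adic order `g` of the face coefficient
ENTERS the reading.  By engine (A): NO point over `y` is near after the package.  At `γ ≡ 0` this is the tree's
`ThresholdGeneric` of `F̄`.  DEFINITION (NEW object). (Sources: Hironaka1967; CossartPiltant2008 proof of Prop. 4.2.) -/
def RelThresholdGeneric (S : Finset (Fin (d + 1) →₀ ℕ)) (γ : (Fin (d + 1) →₀ ℕ) → ℕ)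
    (lamBar : (Fin (d + 1) →₀ ℕ) → K) (n a b : ℕ) : Prop :=
  ¬ b ∣ a ∧ ∀ w : Fin (d + 1) → AlgebraicClosure K, w ≠ 0 → w 0 = 0 →
    ∃ i g : ℕ, (∀ m ∈ S, m 0 = i → g ≤ γ m) ∧
      ∃ m ∈ (translate (geom (vLayer S γ lamBar i g)) w).support,
        thetaNum a b * i + b * (uDeg m + g) < thetaNum a b * n

/-- **(G2ʳ) `RelThresholdGenericPow S γ lamBar n a b`** (`δ ∉ ℤ`, `n = pᵉ`, `p = char k(y)`): the same with `≤`; at a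
near point the bottom-layer witness survives in `in_n` as the MIXED monomial `Zⁱ U₁^{e(i)} V^{g} W^β`, so `in_n` is not
`c·L^{pᵉ}`: `τ ≥ 2` (bed `KV59`: `(Z′² + XY)²`, `τ = 3`).  At `γ ≡ 0` this is the tree's `ThresholdGenericPow`.
DEFINITION (NEW object). (Sources: CossartPiltant2008 proof of Prop. 4.2 (b); CossartPiltant2019 Rem. 3.2.) -/
def RelThresholdGenericPow (S : Finset (Fin (d + 1) →₀ ℕ)) (γ : (Fin (d + 1) →₀ ℕ) → ℕ)
    (lamBar : (Fin (d + 1) →₀ ℕ) → K) (n a b : ℕ) : Prop :=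
  ¬ b ∣ a ∧ (∃ e : ℕ, n = ringChar K ^ e) ∧ ∀ w : Fin (d + 1) → AlgebraicClosure K, w ≠ 0 → w 0 = 0 →
    ∃ i g : ℕ, (∀ m ∈ S, m 0 = i → g ≤ γ m) ∧
      ∃ m ∈ (translate (geom (vLayer S γ lamBar i g)) w).support,
        thetaNum a b * i + b * (uDeg m + g) ≤ thetaNum a b * n

/-- **RELATIVELY δ-GENERIC prepared face**: (G1ʳ) ∨ (G2ʳ) ∨ (G3ʳ := the tree's `SolvGeneric` of the `γ = 0` layer —
no relative gain when `δ ∈ ℤ`, honest).  DEFINITION (NEW object). (Sources: Hironaka1967; CossartPiltant2008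
Prop. 4.2; Moh1987.) -/
def RelDeltaGenericFace (S : Finset (Fin (d + 1) →₀ ℕ)) (γ : (Fin (d + 1) →₀ ℕ) → ℕ)
    (lamBar : (Fin (d + 1) →₀ ℕ) → K) (n a b : ℕ) : Prop :=
  RelThresholdGeneric S γ lamBar n a b ∨ RelThresholdGenericPow S γ lamBar n a b ∨
    SolvGeneric (vLayerZero S γ lamBar) n a b

end RelGenericity

/-! ## §N2  NEW (g13): point level — the prepared relative presentation, uniform REL-curves, ENGINE (A); the flat
presentation (`d = 1`), uniform FLAT curves, ENGINE (B) -/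

/-- **RELATIVE JUMP-GENERICITY at `y` transversal to `η`** (`IsRelJumpGenericAt I n a b η y`): parameters `c` generating
the curve prime, ONE inert parameter `v` with `(c, v) = 𝔪_y` MINIMAL (`spanFinrank = d + 2`, so `𝒪_{C,y} = 𝒪_{Y,y}/(c)`
is a DVR with uniformizer `v̄`), a `v`-PREPARED face `F = vFace S γ lam v` with UNIT coefficients `lam` satisfying the
tree's `HasDeltaFace c (I_y) n a b F` verbatim, and RELATIVE genericity of its layers over `k(y)`.  At a non-jump point
(`γ ≡ 0`) this is g12's `IsRelDeltaGenericAt` with `e = 1` and a prepared face; at a δ-JUMP point (`F mod 𝔪_y` loses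
layers) it is new.  DEFINITION (NEW class predicate: the `v`-adic transversal δ-face). (Sources: Hironaka1967;
CossartJannsenSaito2020 Ch. 8, Ch. 9 Setup B; CossartPiltant2008 Prop. 4.2.) -/
def IsRelJumpGenericAt {Y : Scheme.{0}} (I : Y.IdealSheafData) (n a b : ℕ) (η y : Y) : Prop :=
  ∃ h : η ⤳ y, ∃ (d : ℕ) (c : Fin (d + 1) → Y.presheaf.stalk y) (v : Y.presheaf.stalk y),
    Ideal.span (Set.range c) = curvePrime h ∧
      Ideal.span (Set.range c ∪ {v}) = maximalIdeal (Y.presheaf.stalk y) ∧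
      (maximalIdeal (Y.presheaf.stalk y)).spanFinrank = d + 2 ∧
      ∃ (S : Finset (Fin (d + 1) →₀ ℕ)) (γ : (Fin (d + 1) →₀ ℕ) → ℕ)
        (lam : (Fin (d + 1) →₀ ℕ) → Y.presheaf.stalk y),
        (∀ m ∈ S, IsUnit (lam m)) ∧
          HasDeltaFace c (stalkIdeal I y) n a b (vFace S γ lam v) ∧
          RelDeltaGenericFace S γ (fun m => residue (Y.presheaf.stalk y) (lam m)) n a b

/-- **UNIFORMLY REL-GENERIC CURVE of slope `a/b`** (`IsUniformRelCurve I n a b η`): `η` is a curve point and EVERY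
closed point of `closure {η}` is relatively jump-generic transversal to `η` with the same `(n, a, b)` (the kind
(G1ʳ/G2ʳ/G3ʳ) may vary along the curve), with the equicharacteristic guard `char k(y) = char κ(η)` (automatic over a
field).  The hypothesis of ENGINE (A).  DEFINITION (NEW class predicate). (Sources: Hironaka1967; CossartJannsenSaito2020
Ch. 8, Ch. 9 Setup B.) -/
def IsUniformRelCurve {Y : Scheme.{0}} (I : Y.IdealSheafData) (n a b : ℕ) (η : Y) : Prop :=
  IsCurvePt η ∧ ∀ y : Y, η ⤳ y → IsClosed ({y} : Set Y) →
    ringChar (ResidueField (Y.presheaf.stalk y)) = ringChar (ResidueField (Y.presheaf.stalk η)) ∧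
      IsRelJumpGenericAt I n a b η y

/-- **ENGINE (A) `RelCurvePackageExit`** [DECIDED · paper proof in the module docstring ((0r)(1r)(2r) = g12 verbatim;
(3rʳ): the exponent fact `f^{(m)} ≡ z_mⁱu₁^{e(i)}Ψ_i mod (z_m^{i+1}, u₁^{e(i)+1})`, LEMMA (†) in any regular local
ring giving (N≤) and (I), the `v`-adic bottom-layer reading `s_i(x) ≤ γ(i) + ord Q_{i,γ(i)}` with the un-cancelled
`V^{γ(i)}`-part, conclusions (G1ʳ)/(G2ʳ)/(G3ʳ) over `y`, transfer to the points over `η` by the closed loci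
`S₁/S₂/S₃`
and properness) · characteristic free, EVERY regular scheme, every residue field, every dimension · port L over
`CentreSeq` / `controlledTransform` / `stalkTau`]: on a regular scheme, a uniformly rel-generic curve of order `n ≥ 2`
has an exit package with centres over it (g12's curve package).  STATEMENT (engine). (Sources: Hironaka1967;
CossartJannsenSaito2020 Ch. 2, 8, 9; CossartPiltant2008 Prop. 4.2, Lemma 4.3; Moh1987.) -/
def RelCurvePackageExit : Prop :=
  ∀ (Y : Scheme.{0}), Scheme.IsRegular Y → ∀ (I : Y.IdealSheafData) (n : ℕ), 2 ≤ n →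
    ∀ (η : Y) (a b : ℕ), IsUniformRelCurve I n a b η → PackageExitsOver I n {y : Y | η ⤳ y}

/-- **RELATIVELY FLAT presentation at `y` transversal to `η`, `d = 1`** (`IsFlatOneAt I n η y`): `c = (z, u)` generating
the curve prime, inert `v` with `(c, v) = 𝔪_y` minimal (`spanFinrank = 3`: `C` is a curve of codimension two in a
threefold germ), a UNIT `lam` and `g ∈ (c)^{n+1}` with `zⁿ + lam·v·uⁿ + g ∈ I_y`, and `I_y ⊆ (c)ⁿ` (so
`C ⊆ Supp(I, n)`
at `η` too).  Relative slope EXACTLY ONE: outside every δ-face class (`I_y ⊄ Q(an)` for `a > b`).  Bed: Whitney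
`z² + xy²`, monomialcyl `x² − y²z` (`p = 2`), ppinch:p3e1 `v³ + w³u`, frobline `y³ − tx³` (`p = 3`).
DEFINITION (NEW
class predicate: the normal-cone jump). (Sources: CossartJannsenSaito2020 Ch. 2, Ch. 8; Hironaka1967;
CossartPiltant2008 Prop. 4.2.) -/
def IsFlatOneAt {Y : Scheme.{0}} (I : Y.IdealSheafData) (n : ℕ) (η y : Y) : Prop :=
  ∃ h : η ⤳ y, ∃ (c : Fin 2 → Y.presheaf.stalk y) (v lam g : Y.presheaf.stalk y),
    Ideal.span (Set.range c) = curvePrime h ∧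
      Ideal.span (Set.range c ∪ {v}) = maximalIdeal (Y.presheaf.stalk y) ∧
      (maximalIdeal (Y.presheaf.stalk y)).spanFinrank = 3 ∧
      IsUnit lam ∧ g ∈ Ideal.span (Set.range c) ^ (n + 1) ∧
      c 0 ^ n + lam * v * c 1 ^ n + g ∈ stalkIdeal I y ∧
      stalkIdeal I y ≤ Ideal.span (Set.range c) ^ n

/-- **UNIFORMLY FLAT CURVE** (`IsUniformFlatCurve I n η`): `η` is a curve point and EVERY closed point of `closure {η}`
carries a relatively flat presentation (`d = 1`).  The hypothesis of ENGINE (B).  DEFINITION (NEW class predicate).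
(Sources: CossartJannsenSaito2020 Ch. 2; Hironaka1967.) -/
def IsUniformFlatCurve {Y : Scheme.{0}} (I : Y.IdealSheafData) (n : ℕ) (η : Y) : Prop :=
  IsCurvePt η ∧ ∀ y : Y, η ⤳ y → IsClosed ({y} : Set Y) → IsFlatOneAt I n η y

/-- **ENGINE (B) `NormalConeJumpExit`** [DECIDED · paper proof in the module docstring: `C` regular and inside
`Supp(I, n)`; ONE blow-up of `C`; in the `u`-chart `f' = z₁ⁿ + lam·v + u·h` has order `≤ 1` at every point over a
closed point of `C ∩ V` (`λ̄V` survives mod `𝔪_x²`), in the `z`-chart the transform is a unit; `{ord ≥ n}`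
over `C ∩ V`
is closed with proper image missing `y`, hence `η`: NO near point — the exit clause is vacuous · characteristic free ·
every regular scheme · port L over `CentreSeq` / `controlledTransform`]: on a regular scheme, a uniformly flat curve of
order `n ≥ 2` has an exit package with centres over it (its own blow-up).  STATEMENT (engine). (Sources:
CossartJannsenSaito2020 Ch. 2; Hironaka1967; CossartPiltant2008 Prop. 4.2 (a).) -/
def NormalConeJumpExit : Prop :=
  ∀ (Y : Scheme.{0}), Scheme.IsRegular Y → ∀ (I : Y.IdealSheafData) (n : ℕ), 2 ≤ n →
    ∀ η : Y, IsUniformFlatCurve I n η → PackageExitsOver I n {y : Y | η ⤳ y}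

/-! ## §N3  NEW (g13): pointwise classes at a top point -/

/-- **REL-CURVE-GENERIC point** (NEW DECIDED CLASS, leaf JUMP): `y` lies on (or is the generic point of) a Top-isolated,
uniformly rel-generic curve `closure {η}`.  DEFINITION (NEW class). (Sources: Hironaka1967; CossartJannsenSaito2020 Ch. 8.) -/
def IsRelCurveGenericPt {Y : Scheme.{0}} (I : Y.IdealSheafData) (n : ℕ) (y : Y) : Prop :=
  ∃ (η : Y) (a b : ℕ), η ⤳ y ∧ IsTopIsolatedClosure I n η ∧ IsUniformRelCurve I n a b η

/-- **FLAT-CURVE point** (NEW DECIDED CLASS, leaf FLAT-1): `y` lies on (or is the generic point of) a Top-isolated,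
uniformly flat curve `closure {η}`.  DEFINITION (NEW class). (Sources: CossartJannsenSaito2020 Ch. 2; Hironaka1967.) -/
def IsFlatCurvePt {Y : Scheme.{0}} (I : Y.IdealSheafData) (n : ℕ) (y : Y) : Prop :=
  ∃ η : Y, η ⤳ y ∧ IsTopIsolatedClosure I n η ∧ IsUniformFlatCurve I n η

/-- **LEAF-SPECIAL core point** (THE LOCATED CLASS of this node): relatively special (g12: near-special, not δ-generic,
not curve-generic), NOT rel-curve-generic and NOT a flat-curve point.  DEFINITION (NEW class). [folklore] -/
def IsLeafSpecialPt {k : Type} [Field k] {Y : Scheme.{0}} (g : Y ⟶ Spec (.of k)) (hY : Scheme.IsRegular Y)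
    (I : Y.IdealSheafData) (n : ℕ) (y : Y) : Prop :=
  IsRelSpecialPt g hY I n y ∧ ¬ IsRelCurveGenericPt I n y ∧ ¬ IsFlatCurvePt I n y

/-! ## §N4  The graded statements (fresh-data frame = the binders of `WeakOrderReduction.SeqDimFour`) -/

/-- **`SeqLGen n`** — weak order reduction in dimension four at marking `n` for data ALL of whose top points are of
class ≥ 2, near-generic (g10), δ-generic (g11), curve-generic (g12), REL-CURVE-GENERIC or FLAT-CURVE points (g13).
[DECIDED-MOD-PORT relative to `SeqDimFour 2 n`: `lGenRungAt_of_engines`.]  STATEMENT SCHEMA. (Sources: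
BierstoneGrigorievMilmanWlodarczyk2011 §3.1; CossartPiltant2008 Prop. 4.2; Hironaka1967.) -/
def SeqLGen (n : ℕ) : Prop :=
  ∀ p : ℕ, p.Prime → ∀ (k : Type) [Field k] [CharP k p]
    (Y : Scheme.{0}) (g : Y ⟶ Spec (.of k)), IsSeparated g → LocallyOfFiniteType g → QuasiCompact g →
    ∀ hY : Scheme.IsRegular Y, topologicalKrullDim Y ≤ 4 →
    ∀ I : Y.IdealSheafData, (∀ y : Y, idealOrder I y ≤ ((n : ℕ) : ℕ∞)) →
      (∀ y : Y, idealOrder I y = ((n : ℕ) : ℕ∞) →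
        ClassGE g hY I n 2 y ∨ VeryNearCutClasses.IsNearGenericPt I n y ∨ IsDeltaGenericPt I n y ∨
          IsCurveGenericPt I n y ∨ IsRelCurveGenericPt I n y ∨ IsFlatCurvePt I n y) →
      ∃ t : CentreSeq Y, WeakResolution t (⟨I, [], n⟩ : MarkedIdeal Y)

/-- **`SeqLSpec n`** — THE LOCATED CLASS: weak order reduction in dimension four at marking `n` for data having a
LEAF-SPECIAL core top point.  [UNDECIDED · IDEA-NEEDED · INSTRUMENTABLE T-delta-jump / T-normalcone / T-round-bed.]
STATEMENT SCHEMA. (Sources: BierstoneGrigorievMilmanWlodarczyk2011 §3.1; CossartPiltant2019 Rem. 3.2; Moh1987.) -/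
def SeqLSpec (n : ℕ) : Prop :=
  ∀ p : ℕ, p.Prime → ∀ (k : Type) [Field k] [CharP k p]
    (Y : Scheme.{0}) (g : Y ⟶ Spec (.of k)), IsSeparated g → LocallyOfFiniteType g → QuasiCompact g →
    ∀ hY : Scheme.IsRegular Y, topologicalKrullDim Y ≤ 4 →
    ∀ I : Y.IdealSheafData, (∀ y : Y, idealOrder I y ≤ ((n : ℕ) : ℕ∞)) →
      (∃ y : Y, idealOrder I y = ((n : ℕ) : ℕ∞) ∧ IsLeafSpecialPt g hY I n y) →
      ∃ t : CentreSeq Y, WeakResolution t (⟨I, [], n⟩ : MarkedIdeal Y)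

/-- `SeqLSpecNonIso n` — NON-ISOLATED column of the located class: some leaf-special core top point is NOT isolated in
the top locus.  WEAKER BY LETTER than g12's `SeqRSpecNonIso n`.  [UNDECIDED · sub-cut `seqLSpecNonIso_iff`.]
(Sources: CossartJannsenSaito2020 Ch. 5; CossartPiltant2019 Rem. 3.2.) -/
def SeqLSpecNonIso (n : ℕ) : Prop :=
  ∀ p : ℕ, p.Prime → ∀ (k : Type) [Field k] [CharP k p]
    (Y : Scheme.{0}) (g : Y ⟶ Spec (.of k)), IsSeparated g → LocallyOfFiniteType g → QuasiCompact g →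
    ∀ hY : Scheme.IsRegular Y, topologicalKrullDim Y ≤ 4 →
    ∀ I : Y.IdealSheafData, (∀ y : Y, idealOrder I y ≤ ((n : ℕ) : ℕ∞)) →
      (∃ y : Y, idealOrder I y = ((n : ℕ) : ℕ∞) ∧ IsLeafSpecialPt g hY I n y ∧
        ¬ FaceFormCutClasses.IsIsolatedTop I n y) →
      ∃ t : CentreSeq Y, WeakResolution t (⟨I, [], n⟩ : MarkedIdeal Y)

/-- `SeqLSpecIso n` — ISOLATED column of the located class: leaf-special core top points exist and every one of them is
isolated in the top locus (bed, in frame: g11's three binary towers).  [UNDECIDED · INSTRUMENTABLE T-delta-tower.]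
(Sources: Hironaka1967; Moh1987.) -/
def SeqLSpecIso (n : ℕ) : Prop :=
  ∀ p : ℕ, p.Prime → ∀ (k : Type) [Field k] [CharP k p]
    (Y : Scheme.{0}) (g : Y ⟶ Spec (.of k)), IsSeparated g → LocallyOfFiniteType g → QuasiCompact g →
    ∀ hY : Scheme.IsRegular Y, topologicalKrullDim Y ≤ 4 →
    ∀ I : Y.IdealSheafData, (∀ y : Y, idealOrder I y ≤ ((n : ℕ) : ℕ∞)) →
      (∃ y : Y, idealOrder I y = ((n : ℕ) : ℕ∞) ∧ IsLeafSpecialPt g hY I n y) →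
      (∀ y : Y, idealOrder I y = ((n : ℕ) : ℕ∞) → IsLeafSpecialPt g hY I n y →
        FaceFormCutClasses.IsIsolatedTop I n y) →
      ∃ t : CentreSeq Y, WeakResolution t (⟨I, [], n⟩ : MarkedIdeal Y)

/-- `SeqLSpecCurve n` — CURVE stratum of the non-isolated column AFTER the two leaves left: some non-isolated leaf-special
core top point lies on a clean curve.  What is left here: FLAT-δ (uniformly δ-special regular curves of slope `> 1`:
`ppinch:e2 z² + xy⁴`, `ppinch:p3e2 v³ + w⁹u` — Round material BY NAME 30458/30459 for principal data, 30460 for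
non-principal), SINGULAR Top-isolated top curves (`HauserE7 x² + y⁷ + yz⁴`, cusp; `Narasimhan x² + yz³ + zw³ + y⁷w`),
HIGHER pinch points (`τ(η) ≥ 2 > τ(y)` not of the FLAT-1 shape, e.g. `zⁿ + v²uⁿ`; the FLAT-1 points — the simplest
pinch points — have left), flat curves in a fourfold (`d = 2`, umbrella re-created).  WEAKER BY LETTER than g12's
`SeqRSpecCurve n`.  [UNDECIDED ·
INSTRUMENTABLE T-round-bed / T-uniform · IDEA-NEEDED (multi-round transversal polyhedra).] (Sources:
CossartJannsenSaito2020 Ch. 8–9; Narasimhan1983; CossartPiltant2008 Prop. 4.2.) -/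
def SeqLSpecCurve (n : ℕ) : Prop :=
  ∀ p : ℕ, p.Prime → ∀ (k : Type) [Field k] [CharP k p]
    (Y : Scheme.{0}) (g : Y ⟶ Spec (.of k)), IsSeparated g → LocallyOfFiniteType g → QuasiCompact g →
    ∀ hY : Scheme.IsRegular Y, topologicalKrullDim Y ≤ 4 →
    ∀ I : Y.IdealSheafData, (∀ y : Y, idealOrder I y ≤ ((n : ℕ) : ℕ∞)) →
      (∃ y : Y, idealOrder I y = ((n : ℕ) : ℕ∞) ∧ IsLeafSpecialPt g hY I n y ∧
        ¬ FaceFormCutClasses.IsIsolatedTop I n y ∧ OnCleanCurve I n y) →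
      ∃ t : CentreSeq Y, WeakResolution t (⟨I, [], n⟩ : MarkedIdeal Y)

/-- `SeqLSpecTangle n` — TANGLE stratum of the non-isolated column: non-isolated leaf-special core top points exist and
NONE of them lies on a clean curve (crossing top curves, top surfaces, curves through surfaces — Round material BY NAME
30458/30459/30460).  [UNDECIDED · INSTRUMENTABLE T-round-bed.] (Sources: CossartJannsenSaito2020 Ch. 5;
CossartPiltant2019 Rem. 3.2.) -/
def SeqLSpecTangle (n : ℕ) : Prop :=
  ∀ p : ℕ, p.Prime → ∀ (k : Type) [Field k] [CharP k p]
    (Y : Scheme.{0}) (g : Y ⟶ Spec (.of k)), IsSeparated g → LocallyOfFiniteType g → QuasiCompact g →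
    ∀ hY : Scheme.IsRegular Y, topologicalKrullDim Y ≤ 4 →
    ∀ I : Y.IdealSheafData, (∀ y : Y, idealOrder I y ≤ ((n : ℕ) : ℕ∞)) →
      (∃ y : Y, idealOrder I y = ((n : ℕ) : ℕ∞) ∧ IsLeafSpecialPt g hY I n y ∧
        ¬ FaceFormCutClasses.IsIsolatedTop I n y) →
      (∀ y : Y, idealOrder I y = ((n : ℕ) : ℕ∞) → IsLeafSpecialPt g hY I n y →
        ¬ FaceFormCutClasses.IsIsolatedTop I n y → ¬ OnCleanCurve I n y) →
      ∃ t : CentreSeq Y, WeakResolution t (⟨I, [], n⟩ : MarkedIdeal Y)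

/-- `LGenRungAt n` — the decided rung at one marking: `SeqDimFour 2 n → SeqLGen n`.  [DECIDED-MOD-PORT, `n ≥ 2`:
`lGenRungAt_of_engines`; `n = 1`: `lGenRungAt_one`.] [folklore] -/
def LGenRungAt (n : ℕ) : Prop := SeqDimFour 2 n → SeqLGen n

/-- **`LeafGenericRung`** — the DECIDED half of `RungOne`: `E 2 →` weak order reduction for every marking and all data
whose core top points are near-generic, δ-generic, curve-generic, rel-curve-generic or flat-curve points.  [WEAKER ·
DECIDED-MOD-PORT(M+): `leafGenericRung_of_engines`.]  STATEMENT (decided piece). (Sources: CossartPiltant2008 Prop. 4.2;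
Hironaka1967; CossartJannsenSaito2020 Ch. 2, Ch. 8.) -/
def LeafGenericRung : Prop := E 2 → ∀ n : ℕ, 1 ≤ n → SeqLGen n

/-- **`LeafSpecialRung`** — THE LOCATED RESIDUAL of this node: `E 2 →` weak order reduction for every marking and all
data with a leaf-special core top point.  [WEAKER BY LETTER · UNDECIDED · IDEA-NEEDED · cofinal ⇒ score 0.]
STATEMENT (located residual). (Sources: CossartPiltant2019 Rem. 3.2; Moh1987; Giraud1975; Narasimhan1983.) -/
def LeafSpecialRung : Prop := E 2 → ∀ n : ℕ, 1 ≤ n → SeqLSpec n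


end Summit.ResolutionOfSingularities.ResolutionOfSingularities.Theorems.CurveLeafExit
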